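import Summits.HodgeConjecture.HodgeConjecture.Theses.AmpleAdicLefschetz
import Literature.AlgebraicGeometry.HodgeTheory.ComplexOrientationFamily
import Literature.AlgebraicGeometry.HodgeTheory.SupportedHodgeClassDescent
import Literature.AlgebraicTopology.SingularHomology.GysinMapSupportProofs
import Literature.AlgebraicGeometry.Motives.VarietiesDimensionProofs
import Literature.AlgebraicGeometry.HodgeTheory.RelativeHyperplaneClassHodgeRiemann
import Literature.AlgebraicGeometry.HodgeTheory.HardLefschetzHodgeRiemannHolds
import Literature.AlgebraicGeometry.HodgeTheory.HodgeTypePullback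
import Literature.AlgebraicGeometry.HodgeTheory.AlgebraicClassesHodgeTypeHolds
import Literature.AlgebraicGeometry.HodgeTheory.SupportedClassesRationalProofs
import Literature.AlgebraicGeometry.HodgeTheory.ComplexConjugationHolds
import Summits.HodgeConjecture.HodgeConjecture.Theorems.AmpleAdicLefschetzThickDescentWeakLefschetzSurjective
import Summits.HodgeConjecture.HodgeConjecture.Theorems.AmpleAdicLefschetzThickDescentGysinZeroCup
import Summits.HodgeConjecture.HodgeConjecture.Theorems.AmpleAdicLefschetzThickDescentTransversalAboveMiddle
import Summits.HodgeConjecture.HodgeConjecture.Theorems.AmpleAdicLefschetzThickDescentPrimitiveOfOrthogonal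
import Summits.HodgeConjecture.HodgeConjecture.Theorems.AmpleAdicLefschetzThickDescentAnisotropicKernel
import HarnessLib

/-!
# Line `birth` (rev 2, lead reshape) — skeleton for the crux `ThickDescent` (stmt-HodgeConjecture-2613)

Route `AmpleAdicLefschetz`, crux #2 `ThickDescent` (THICK): for a closed immersion `f : Y ⟶ X` of
smooth projective complex varieties (`dim X = n`, `dim Y = m`), a finite set `s` of affine opens of
`X` covering exactly `X ∖ f(Y)` and `2p + |s| ≤ n`, every ALGEBRAIC class `c ∈ Nᵖ H²ᵖ(Y(ℂ); ℂ)` in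
the image of `f^* : H²ᵖ(X(ℂ); ℂ) → H²ᵖ(Y(ℂ); ℂ)` is `f^* a` for an ALGEBRAIC `a ∈ Nᵖ H²ᵖ(X(ℂ); ℂ)`.

THE LINE (unchanged idea: GYSIN TRANSPORT + LEFSCHETZ-TYPE REFLECTION, `Lines/birth.md`). Given
`c = f^* a₀ ∈ Alg^p(Y)`: `f_* c ∈ Alg^q(X)` (`complexGysin_mem_algebraicClasses`, proved), REFLECTION
(`stub_gysinPullbackReflectsAlgebraic`, the open heart) gives `a ∈ Alg^p(X)` with
`f_* f^* a = f_* f^* a₀`, and TRANSVERSALITY (`ker (f_* ∘ f^*) = ker f^*` on the classes that matter)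
applied to `x = a - a₀` gives `f^* a = c`.

RESHAPE (lead, 2026-08-17). The registered topological stub `stub_gysinKernelTransverse` (`f_* f^* x = 0
⇒ f^* x = 0` for ALL `x ∈ H²ᵖ(X(ℂ); ℂ)`) needs the Hodge–Riemann relations on `(a,b)`-classes with
`a ≠ b`, which the tree has NOT transported to the summit carriers (`HardLefschetzHodgeRiemannHolds`,
"What is NOT here"). The composition only ever applies transversality to `x = a - a₀` whose
restriction `f^* x = f^* a - c` lies in the `ℂ`-span of RATIONAL `(p,p)`-classes of `Y` (algebraic
classes are rational-spanned and of type `(p,p)`: `supportedClasses_le_span_isRationalClass`,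
`isOfHodgeType_of_mem_algebraicClasses_of_isSmoothProjective`, both PROVED; pull-back preserves both:
`IsRationalClass.map`, `IsOfHodgeType.map_of_le`). On that span the SIGN-FREE Hodge–Riemann anisotropy
of a Kähler class on rational primitive `(p,p)`-classes (`HodgeModel.IsKaehlerClassVia.hodgeRiemann_anisotropy`,
PROVED) suffices. So `stub_gysinKernelTransverse` is cut into five tree-sized THEOREM-grade stubs, all
statements about the tree's real carriers with every Hodge-theoretic input either PROVED in the tree or
an explicit hypothesis discharged in the glue:

* `stub_weakLefschetzSurjective` — weak Lefschetz, SURJECTIVITY half, affine-cover form: `f^*` onto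
  `Hʲ(Y(ℂ))` for `j + |s| + 1 ≤ n` (mirror of the landed `Theorems.weakLefschetzInjective_proof`:
  `H_q((X∖Y)(ℂ)) = 0` for `q ≥ n + |s|` by Andreotti–Frankel + Mayer–Vietoris, then
  `singularCohomology.map_subtypeVal_surjective_of_isZero_compl`). Voisin II Thm. 1.23.
* `stub_gysinZero_cup` — GYSIN TRANSPOSE: `f_* x' = 0 ⇒ x' ∪ f^* y = 0` for all `y` of complementary
  degree (`cupPairing_gysinMap`: `⟨f_* x' ∪ y, [X]⟩ = ⟨x' ∪ f^* y, [Y]⟩`, and `H^{2m}(Y(ℂ)) → ℂ`,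
  `z ↦ ⟨z, [Y]⟩` is injective: `eq_zero_of_kroneckerPairing_fundamentalClass_eq_zero`). Fulton (6).
* `stub_transversal_aboveMiddle` — above the middle of `Y` no Hodge theory is needed: if `f^*` is onto
  `Hᵏ(Y)` (`2p + k = 2m`) and `f^* x ∪ f^* y = 0` for all `y`, then `f^* x = 0` (Poincaré perfectness
  `isPerfPair_cupPairing_complexPoints`).
* `stub_primitive_of_orthogonal` — LEFSCHETZ REDUCTION (hard Lefschetz + Poincaré duality only): for a
  class `κ ∈ H²(X)` whose restriction `f^*κ` has the hard Lefschetz property on `Y`, if `f^*` is onto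
  `Hⁱ(Y)` for `i ≤ 2p - 2` and `f^* x ⊥ f^* H^{2m-2p}(X)`, then `f^* x` is PRIMITIVE
  (`L^{m-2p+1} f^* x = 0`): the non-primitive Lefschetz components `Lʲ x'_j`, `j ≥ 1`, are restricted
  classes and pair perfectly with restricted classes (`primitivePart`, `sum_lefschetzPowTo_primitivePart`,
  `cupProduct_lefschetzPowTo_lefschetzPowTo`, `isPerfPair_cupPairing_complexPoints`). Voisin I Cor. 6.26.
* `stub_anisotropicKernel` — ANISOTROPY STEP (rational linear algebra + sign-free Hodge–Riemann as a
  HYPOTHESIS `hHR`): a primitive restricted class in the span of rational `(p,p)`-classes which is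
  `⊥ f^* H^{2m-2p}(X)` vanishes (functional trick `sum_smul_mem_span_dual` /
  `linearIndependent_of_isRationalClass`; the Gram matrix of `(r, r') ↦ Lˢ r ∪ r'` on a `ℚ`-independent
  family of rational primitive `(p,p)` restricted classes is anisotropic by `hHR`, hence invertible).
* `stub_gysinPullbackReflectsAlgebraic` — REFLECTION (unchanged, registered 2026-08-17): the open,
  crux-sized heart (sub-middle algebraic-input fragment of `A(X, η)`; HC-implied).

The glue `thickDescent_of_pieces` (sorry-free) supplies: the Gysin degree (`dim_le_of_isClosedImmersion`),
the degenerate range `2p > 2m` (`subsingleton_complexBetti`), the transport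
(`complexGysin_mem_algebraicClasses`), the Kähler class of `Y` RESTRICTED FROM `X`
(`exists_kaehlerRationalDatum_eq_map` for the embedding `f ≫ ι_X`, so `κ_Y = f^* ι_X^* c₀`), its hard
Lefschetz property (`KaehlerRationalDatum.hasHardLefschetzProperty`) and Hodge–Riemann anisotropy
(`HodgeModel.IsKaehlerClassVia.hodgeRiemann_anisotropy`), and the rational-`(p,p)` span membership of
`f^*(a - a₀)`. `ThickDescent_of : ThickDescent` concludes the crux BY NAME from the six stubs.
`sorry` occurs ONLY in `stub_gysinPullbackReflectsAlgebraic` (the five other stubs are LANDED theorems of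
`Summits/HodgeConjecture/HodgeConjecture/Theorems/AmpleAdicLefschetzThickDescent*.lean`, 2026-08-17).

## References

* C. Voisin, *Hodge Theory and Complex Algebraic Geometry I* (2002), Thm. 6.25, Cor. 6.26, Thm. 6.32,
  §7.1.2, Thm. 7.10, §7.3.2; *II* (2003), Thm. 1.22–1.23. [VoisinHodgeI2002, VoisinHodgeII2003]
* W. Fulton, *Young Tableaux* (1997), App. B §B.1 (5)–(6). [FultonYoungTableaux1997]
* A. Grothendieck, *Standard conjectures on algebraic cycles* (1968), §3. [Grothendieck1968]
* S. Kleiman, *Algebraic cycles and the Weil conjectures* (1968), §2. [Kleiman1968]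
* C. Voisin, *Hodge and generalized Hodge conjectures, coniveau and algebraic cycles* (2025), §2.1,
  Cor. 2.12. [Voisin2025]
* A. Hatcher, *Algebraic Topology* (2002), §3.1 p. 198, Thm. 3.30. [HatcherAT2002]
-/

-- `Summit.<Summit>.<Problem>`: for the single-conjunct summit `HodgeConjecture` the duplicate component is mandated.
set_option linter.dupNamespace false
set_option linter.unusedVariables false

noncomputable section

namespace Summit.HodgeConjecture.HodgeConjecture.Cruxes.ThickDescent.Birth

open CategoryTheory AlgebraicGeometry
open Literature.AlgebraicGeometry Literature.AlgebraicGeometry.Motives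
open Literature.AlgebraicGeometry.HodgeTheory
open Literature.AlgebraicTopology.SingularHomology
open Literature.Geometry.Kaehler
open Summit.HodgeConjecture.HodgeConjecture.Theses.AmpleAdicLefschetz

/-! ## The six registered stubs -/

/-- **Stub A `stub_weakLefschetzSurjective`** — WEAK LEFSCHETZ, SURJECTIVITY HALF, AFFINE-COVER FORM:
for `X` smooth projective of dimension `n`, ANY closed immersion `f : Y ⟶ X` and a finite set `s` of
affine opens covering exactly `X ∖ f(Y)`, `f^* : Hʲ(X(ℂ); ℂ) → Hʲ(Y(ℂ); ℂ)` is surjective for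
`j + |s| + 1 ≤ n`. Proof in print / on the tree: `H_q((X ∖ Y)(ℂ); ℂ) = 0` for `q ≥ n + |s|`
(`Theorems.isZero_singularHomology_ptsOver_biUnion_of_andreottiFrankel` with
`Theorems.andreottiFrankel_affineOpen`), `K = f(Y(ℂ))` is compact and locally contractible
(`locallyContractibleSpace_complexPoints_of_isSmoothProjective`), hence taut, and
`singularCohomology.map_subtypeVal_surjective_of_isZero_compl` with `q - 1 = 2n - j - 1 ≥ n + |s|`.
[cite: VoisinHodgeII2003, §1.2.2 Thm. 1.22–1.23] -/
theorem stub_weakLefschetzSurjective :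
    ∀ ⦃n : ℕ⦄ ⦃X Y : SchemeOver ℂ⦄ (f : Y ⟶ X), IsSmoothProjective n X → IsClosedImmersion f.left →
      ∀ (s : Finset X.left.Opens), (∀ U ∈ s, IsAffineOpen U) →
      (⋃ U ∈ s, (U : Set X.left)) = (Set.range f.left.base)ᶜ →
      ∀ (j : ℕ), j + s.card + 1 ≤ n → Function.Surjective (complexBetti.map f j) :=
  Summit.HodgeConjecture.HodgeConjecture.Theorems.stub_weakLefschetzSurjective

/-- **Stub B `stub_gysinZero_cup`** — THE GYSIN MORPHISM IS THE POINCARÉ TRANSPOSE OF `f^*`: for a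
morphism `f : Y ⟶ X` of smooth projective varieties (`dim X = n`, `dim Y = m`), degrees
`a + 2n = b + 2m`, `a + k = 2m`, and `x' ∈ Hᵃ(Y(ℂ); ℂ)` with `f_* x' = 0` (`f_*` the Gysin morphism of
`complexOrientationFamily`): `x' ∪ f^* y = 0` in `H^{2m}(Y(ℂ); ℂ)` for every `y ∈ Hᵏ(X(ℂ); ℂ)`.
On the tree: `complexGysin = gysinMap` (`complexGysin_eq_gysinMap`, `a ≤ 2m`), `cupPairing_gysinMap`
(`⟨f_* x' ∪ y, [X]⟩ = ⟨x' ∪ f^* y, [Y]⟩`, Poincaré duality `hasPoincareDuality_complexOrientationFamily`)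
and `eq_zero_of_kroneckerPairing_fundamentalClass_eq_zero`. [cite: FultonYoungTableaux1997, Appendix B §B.1 (5)–(6)] -/
theorem stub_gysinZero_cup :
    ∀ ⦃n m a b k : ℕ⦄ ⦃X Y : SchemeOver ℂ⦄ (f : Y ⟶ X) (hX : IsSmoothProjective n X)
      (hY : IsSmoothProjective m Y) (hab : a + 2 * n = b + 2 * m) (hk : a + k = 2 * m)
      (x' : complexBetti Y a),
      complexGysin complexOrientationFamily hY hX f hab x' = 0 →
      ∀ y : complexBetti X k, cupProduct hk x' (complexBetti.map f k y) = 0 :=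
  Summit.HodgeConjecture.HodgeConjecture.Theorems.stub_gysinZero_cup

/-- **Stub C0 `stub_transversal_aboveMiddle`** — POINCARÉ DUALITY STEP: for a morphism `f : Y ⟶ X`
into (from) a smooth projective `Y` of dimension `m`, `2p + k = 2m`, if `f^* : Hᵏ(X(ℂ)) → Hᵏ(Y(ℂ))` is
surjective and `f^* x ∪ f^* y = 0` for all `y ∈ Hᵏ(X(ℂ))`, then `f^* x = 0` (the cup pairing
`H²ᵖ(Y(ℂ)) × Hᵏ(Y(ℂ)) → H^{2m}(Y(ℂ))` is perfect: `isPerfPair_cupPairing_complexPoints`).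
[cite: HatcherAT2002, §3.3 Thm. 3.30 and Prop. 3.38] -/
theorem stub_transversal_aboveMiddle :
    ∀ ⦃m p k : ℕ⦄ ⦃X Y : SchemeOver ℂ⦄ (f : Y ⟶ X) (hY : IsSmoothProjective m Y)
      (hk : 2 * p + k = 2 * m) (x : complexBetti X (2 * p)),
      Function.Surjective (complexBetti.map f k) →
      (∀ y : complexBetti X k,
        cupProduct hk (complexBetti.map f (2 * p) x) (complexBetti.map f k y) = 0) →
      complexBetti.map f (2 * p) x = 0 :=
  Summit.HodgeConjecture.HodgeConjecture.Theorems.stub_transversal_aboveMiddle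

/-- **Stub C1 `stub_primitive_of_orthogonal`** — LEFSCHETZ REDUCTION TO THE PRIMITIVE PART: `Y` smooth
projective of dimension `m = 2p + s`, `f : Y ⟶ X` a morphism, `κ ∈ H²(X(ℂ); ℂ)` a class whose
restriction `f^* κ` has the hard Lefschetz property in dimension `m`; if `f^*` is onto `Hⁱ(Y(ℂ))` for
all `i ≤ 2p - 2` and `f^* x ∪ f^* y = 0` for every `y ∈ H^{2m-2p}(X(ℂ))`, then `f^* x` is PRIMITIVE:
`L^{s+1}_{f^*κ} (f^* x) = 0`. Proof: Lefschetz-decompose `f^* x = Σ_j Lʲ x'_j` (`primitivePart`,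
`sum_lefschetzPowTo_primitivePart`, `subsingleton_complexBetti` for `hvan`); for `j ≥ 1` every primitive
`b ∈ P^{2p-2j}(Y)` is `f^* v` (surjectivity), and `y = κ^{s+j} ∪ v` in the hypothesis gives, after
moving powers of `κ` across the cup product (`cupProduct_lefschetzPowTo_lefschetzPowTo`,
`lefschetzPow_map`) and killing the cross terms by primitivity, `x'_j ∪ L^{m-(2p-2j)} b = 0` for all
primitive `b`, whence `x'_j = 0` (hard Lefschetz + `isPerfPair_cupPairing_complexPoints`).
[cite: VoisinHodgeI2002, §6.2.3 Thm. 6.25 and Cor. 6.26] -/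
theorem stub_primitive_of_orthogonal :
    ∀ ⦃m p s k : ℕ⦄ ⦃X Y : SchemeOver ℂ⦄ (f : Y ⟶ X) (hY : IsSmoothProjective m Y)
      (hs : 2 * p + s = m) (hk : 2 * p + k = 2 * m) (κ : complexBetti X 2),
      HasHardLefschetzProperty (complexBetti.map f 2 κ) m →
      (∀ i : ℕ, i + 2 ≤ 2 * p → Function.Surjective (complexBetti.map f i)) →
      ∀ (x : complexBetti X (2 * p)),
      (∀ y : complexBetti X k,
        cupProduct hk (complexBetti.map f (2 * p) x) (complexBetti.map f k y) = 0) →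
      lefschetzPowTo (complexBetti.map f 2 κ) (s + 1) (2 * p) (2 * p + 2 * (s + 1)) rfl
        (complexBetti.map f (2 * p) x) = 0 :=
  Summit.HodgeConjecture.HodgeConjecture.Theorems.stub_primitive_of_orthogonal

/-- **Stub C2 `stub_anisotropicKernel`** — THE ANISOTROPY STEP: `X`, `Y` smooth projective
(`dim Y = m = 2p + s`, `2p + k = 2m`), `f : Y ⟶ X`, `κ ∈ H²(X(ℂ); ℂ)` with `f^* κ` RATIONAL and
satisfying the sign-free Hodge–Riemann anisotropy `hHR` on rational primitive `(p,p)`-classes of `Y`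
(for `y` rational of type `(p,p)`, `L^{s+1} y = 0`, `y ≠ 0`: `Lˢ y ∪ y ≠ 0`). If `f^* x` lies in the
`ℂ`-span of the rational `(p,p)`-classes, is primitive, and `f^* x ∪ f^* y = 0` for all
`y ∈ Hᵏ(X(ℂ))`, then `f^* x = 0`. Proof: expand `x` over rational classes of `X`
(`span_isRationalClass_eq_top_of_isSmoothProjective_holds`) and `f^* x` over rational `(p,p)`-classes;
the functional trick (`sum_smul_mem_span_dual`, `linearIndependent_of_isRationalClass`) puts `f^* x` in
the `ℂ`-span of a `ℚ`-independent family `r_l` of rational, `(p,p)`, primitive, RESTRICTED classes; the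
Gram matrix `(Lˢ r_l ∪ r_{l'})_{l,l'}` (rational entries in the line `H^{2m}(Y(ℂ); ℂ)`,
`finrank_complexBetti_top`) is anisotropic over `ℚ` by `hHR`, hence invertible, and `f^* x ⊥ r_l`
(restricted classes, `cupProduct_lefschetzPowTo_lefschetzPowTo`, `lefschetzPow_map`) forces all
coefficients to vanish. [cite: VoisinHodgeI2002, §6.3.2 Thm. 6.32 and §7.1.2] [cite: HatcherAT2002, §3.1 p. 198] -/
theorem stub_anisotropicKernel :
    ∀ ⦃n m p s k : ℕ⦄ ⦃X Y : SchemeOver ℂ⦄ (f : Y ⟶ X) (hX : IsSmoothProjective n X)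
      (hY : IsSmoothProjective m Y) (hs : 2 * p + s = m) (hk : 2 * p + k = 2 * m)
      (κ : complexBetti X 2), IsRationalClass (complexBetti.map f 2 κ) →
      (∀ y : complexBetti Y (2 * p), IsRationalClass y → IsOfHodgeType m Y (2 * p) p p y →
        lefschetzPowTo (complexBetti.map f 2 κ) (s + 1) (2 * p) (2 * p + 2 * (s + 1)) rfl y = 0 →
        y ≠ 0 →
        cupProduct (show 2 * p + 2 * s + 2 * p = 2 * m by omega)
          (lefschetzPowTo (complexBetti.map f 2 κ) s (2 * p) (2 * p + 2 * s) rfl y) y ≠ 0) →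
      ∀ (x : complexBetti X (2 * p)),
      complexBetti.map f (2 * p) x ∈ Submodule.span ℂ
        {r : complexBetti Y (2 * p) | IsRationalClass r ∧ IsOfHodgeType m Y (2 * p) p p r} →
      lefschetzPowTo (complexBetti.map f 2 κ) (s + 1) (2 * p) (2 * p + 2 * (s + 1)) rfl
        (complexBetti.map f (2 * p) x) = 0 →
      (∀ y : complexBetti X k,
        cupProduct hk (complexBetti.map f (2 * p) x) (complexBetti.map f k y) = 0) →
      complexBetti.map f (2 * p) x = 0 :=
  Summit.HodgeConjecture.HodgeConjecture.Theorems.stub_anisotropicKernel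

/-- **Stub R `stub_gysinPullbackReflectsAlgebraic`** — GYSIN–PULL-BACK REFLECTS ALGEBRAICITY
(unchanged since registration): for `f : Y ⟶ X` between smooth projective varieties, an ALGEBRAIC class
of `X` of the form `f_* f^* x` (`f_*` the Gysin morphism of `complexOrientationFamily`,
`2p + 2n = 2q + 2m`) is `f_* f^* a` with `a` ALGEBRAIC of codimension `p`. THE HARDEST STUB —
open-problem grade, the cycle-theoretic heart of THICK in transferred form: a statement about `X` alone
and the algebraic correspondence `f_* ∘ f^* = (· ∪ f_* 1_Y)`; for c.i. sections of the polarising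
system it is the sub-middle algebraic-input fragment of `A(X, η)` (`StandardConjectureA`) and follows
from `B(X)` (Kleiman), true for abelian varieties (Lieberman 1968) and at the motivated level
(André 1996); implied by the Hodge conjecture for `X` in degree `2p` (Voisin 2025 §2.1 / Cor. 2.12), so
not refutable short of a counterexample to the Hodge conjecture. [cite: Grothendieck1968, §3 p. 196]
[cite: Kleiman1968, §2] [cite: Lieberman1968] [cite: Andre1996Motifs, §0.2–0.3] [cite: Voisin2025, §2.1 and Cor. 2.12] -/
theorem stub_gysinPullbackReflectsAlgebraic :
    ∀ ⦃n m p q : ℕ⦄ ⦃X Y : SchemeOver ℂ⦄ (f : Y ⟶ X) (hX : IsSmoothProjective n X)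
      (hY : IsSmoothProjective m Y) (hpq : 2 * p + 2 * n = 2 * q + 2 * m) (x : complexBetti X (2 * p)),
      complexGysin complexOrientationFamily hY hX f hpq (complexBetti.map f (2 * p) x) ∈
          algebraicClasses X q →
        ∃ a ∈ algebraicClasses X p,
          complexGysin complexOrientationFamily hY hX f hpq (complexBetti.map f (2 * p) a) =
            complexGysin complexOrientationFamily hY hX f hpq (complexBetti.map f (2 * p) x) := by
  sorry

/-! ## Sorry-free glue -/

/-- **`dim Y ≤ dim X` for a closed immersion `Y ⟶ X` of smooth projective varieties**: the topological
Krull dimension is monotone along the closed embedding `Y(Zar) ↪ X(Zar)` and equals `m`, resp. `n`, for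
the smooth irreducible `Y`, resp. `X` (`Motives.topologicalKrullDim_eq_of_smoothOfRelativeDimension`).
[cite: Hartshorne1977, I Prop. 1.10 and II Ex. 3.20] -/
theorem dim_le_of_isClosedImmersion {n m : ℕ} {X Y : SchemeOver ℂ} (hX : IsSmoothProjective n X)
    (hY : IsSmoothProjective m Y) (f : Y ⟶ X) [IsClosedImmersion f.left] : m ≤ n := by
  haveI := hX.smoothOfRelativeDimension
  haveI := hY.smoothOfRelativeDimension
  haveI : IrreducibleSpace ↥X.left := irreducibleSpace_of_isSmoothProjective' hX
  haveI : IrreducibleSpace ↥Y.left := irreducibleSpace_of_isSmoothProjective' hY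
  have h1 : topologicalKrullDim Y.left = m :=
    Motives.topologicalKrullDim_eq_of_smoothOfRelativeDimension Y.hom m
  have h2 : topologicalKrullDim X.left = n :=
    Motives.topologicalKrullDim_eq_of_smoothOfRelativeDimension X.hom n
  have h3 : topologicalKrullDim Y.left ≤ topologicalKrullDim X.left :=
    f.left.isClosedEmbedding.isInducing.topologicalKrullDim_le
  rw [h1, h2] at h3
  exact_mod_cast h3

/-- **Algebraic classes lie in the `ℂ`-span of the rational `(p,p)`-classes** (`X` smooth projective of
dimension `d`): `Nᵖ H²ᵖ` is spanned by its rational members (`supportedClasses_le_span_isRationalClass`)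
and each algebraic class is of Hodge type `(p,p)`
(`isOfHodgeType_of_mem_algebraicClasses_of_isSmoothProjective`). [cite: Deligne2000, §1]
[cite: GrothendieckTopology1969, pp. 299–300] -/
theorem algebraicClasses_le_span_rational_pp {d : ℕ} {Z : SchemeOver ℂ} (hZ : IsSmoothProjective d Z)
    (p : ℕ) :
    algebraicClasses Z p ≤ Submodule.span ℂ
      {r : complexBetti Z (2 * p) | IsRationalClass r ∧ IsOfHodgeType d Z (2 * p) p p r} := by
  intro z hz
  have h1 := supportedClasses_le_span_isRationalClass hZ (2 * p) p hz
  refine Submodule.span_mono ?_ h1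
  rintro r ⟨hrQ, hrA⟩
  exact ⟨hrQ, isOfHodgeType_of_mem_algebraicClasses_of_isSmoothProjective hZ p hrA⟩

/-- **Pull-back maps the rational-`(p,p)` span of `X` into that of `Y`** for a morphism `f : Y ⟶ X` of
smooth projective varieties with `dim Y ≤ dim X` (`IsRationalClass.map`, `IsOfHodgeType.map_of_le`
with a Hodge model of `Y` from `nonempty_hodgeModel_holds`). [cite: VoisinHodgeI2002, §7.3.2] -/
theorem map_span_rational_pp_le {n m : ℕ} {X Y : SchemeOver ℂ} (hX : IsSmoothProjective n X)
    (hY : IsSmoothProjective m Y) (f : Y ⟶ X) (hmn : m ≤ n) (p : ℕ) :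
    (Submodule.span ℂ
        {r : complexBetti X (2 * p) | IsRationalClass r ∧ IsOfHodgeType n X (2 * p) p p r}).map
      (complexBetti.map f (2 * p)).hom ≤
    Submodule.span ℂ
      {r : complexBetti Y (2 * p) | IsRationalClass r ∧ IsOfHodgeType m Y (2 * p) p p r} := by
  obtain ⟨B⟩ := (nonempty_hodgeModel_holds (n := m) (X := Y)).nonempty hY
  refine (Submodule.map_span_le _ _ _).2 ?_
  rintro r ⟨hrQ, hrT⟩
  exact Submodule.subset_span ⟨hrQ.map _, hrT.map_of_le hY hX B f hmn⟩

/-- **The composition with explicit hypotheses** (`stub_A → stub_B → stub_C0 → stub_C1 → stub_C2 →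
stub_R → crux`, the crux `ThickDescent` written out one step so that `ThickDescent_of` below is the
file's only theorem headed by the crux name). GYSIN TRANSPORT: `c = f^* a₀ ∈ Alg^p(Y)`; if `2p > 2m`
then `H²ᵖ(Y(ℂ)) = 0` and `a = 0` serves; else the Gysin degree `2q = 2p + 2(n - m)` exists
(`dim_le_of_isClosedImmersion`), `f_* c ∈ Alg^q(X)` (`complexGysin_mem_algebraicClasses`); REFLECTION
(`hR`) gives `a ∈ Alg^p(X)` with `f_* f^* a = f_* f^* a₀`; for `x = a - a₀`, TRANSPOSE (`hB`) gives
`f^* x ⊥ f^* H^{2m-2p}(X)`; above the middle of `Y` (`m < 2p`) `hC0` with the surjectivity `hA` in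
degree `2m - 2p ≤ n - |s| - 1` gives `f^* x = 0`; at or below it, with the Kähler class of `Y`
restricted from a projective embedding `f ≫ ι` of `X` (`exists_kaehlerRationalDatum_eq_map`: hard
Lefschetz `KaehlerRationalDatum.hasHardLefschetzProperty`, Hodge–Riemann anisotropy
`HodgeModel.IsKaehlerClassVia.hodgeRiemann_anisotropy`), `hC1` (surjectivity `hA` in degrees
`≤ 2p - 2 ≤ n - |s| - 2`) makes `f^* x` primitive and `hC2` (with `f^* x` in the rational-`(p,p)` span:
`algebraicClasses_le_span_rational_pp`, `map_span_rational_pp_le`) kills it. Hence `f^* a = c`.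
Sorry-free; standard axioms. [cite: Voisin2025, §2.1 and §4.1 Example 4.2]
[cite: FultonYoungTableaux1997, Appendix B §B.1 (5)–(7)] [cite: VoisinHodgeI2002, Thm. 6.25 and Thm. 6.32] -/
theorem thickDescent_of_pieces
    (hA : ∀ ⦃n : ℕ⦄ ⦃X Y : SchemeOver ℂ⦄ (f : Y ⟶ X), IsSmoothProjective n X → IsClosedImmersion f.left →
      ∀ (s : Finset X.left.Opens), (∀ U ∈ s, IsAffineOpen U) →
      (⋃ U ∈ s, (U : Set X.left)) = (Set.range f.left.base)ᶜ →
      ∀ (j : ℕ), j + s.card + 1 ≤ n → Function.Surjective (complexBetti.map f j))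
    (hB : ∀ ⦃n m a b k : ℕ⦄ ⦃X Y : SchemeOver ℂ⦄ (f : Y ⟶ X) (hX : IsSmoothProjective n X)
      (hY : IsSmoothProjective m Y) (hab : a + 2 * n = b + 2 * m) (hk : a + k = 2 * m)
      (x' : complexBetti Y a),
      complexGysin complexOrientationFamily hY hX f hab x' = 0 →
      ∀ y : complexBetti X k, cupProduct hk x' (complexBetti.map f k y) = 0)
    (hC0 : ∀ ⦃m p k : ℕ⦄ ⦃X Y : SchemeOver ℂ⦄ (f : Y ⟶ X) (hY : IsSmoothProjective m Y)
      (hk : 2 * p + k = 2 * m) (x : complexBetti X (2 * p)),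
      Function.Surjective (complexBetti.map f k) →
      (∀ y : complexBetti X k,
        cupProduct hk (complexBetti.map f (2 * p) x) (complexBetti.map f k y) = 0) →
      complexBetti.map f (2 * p) x = 0)
    (hC1 : ∀ ⦃m p s k : ℕ⦄ ⦃X Y : SchemeOver ℂ⦄ (f : Y ⟶ X) (hY : IsSmoothProjective m Y)
      (hs : 2 * p + s = m) (hk : 2 * p + k = 2 * m) (κ : complexBetti X 2),
      HasHardLefschetzProperty (complexBetti.map f 2 κ) m →
      (∀ i : ℕ, i + 2 ≤ 2 * p → Function.Surjective (complexBetti.map f i)) →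
      ∀ (x : complexBetti X (2 * p)),
      (∀ y : complexBetti X k,
        cupProduct hk (complexBetti.map f (2 * p) x) (complexBetti.map f k y) = 0) →
      lefschetzPowTo (complexBetti.map f 2 κ) (s + 1) (2 * p) (2 * p + 2 * (s + 1)) rfl
        (complexBetti.map f (2 * p) x) = 0)
    (hC2 : ∀ ⦃n m p s k : ℕ⦄ ⦃X Y : SchemeOver ℂ⦄ (f : Y ⟶ X) (hX : IsSmoothProjective n X)
      (hY : IsSmoothProjective m Y) (hs : 2 * p + s = m) (hk : 2 * p + k = 2 * m)
      (κ : complexBetti X 2), IsRationalClass (complexBetti.map f 2 κ) →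
      (∀ y : complexBetti Y (2 * p), IsRationalClass y → IsOfHodgeType m Y (2 * p) p p y →
        lefschetzPowTo (complexBetti.map f 2 κ) (s + 1) (2 * p) (2 * p + 2 * (s + 1)) rfl y = 0 →
        y ≠ 0 →
        cupProduct (show 2 * p + 2 * s + 2 * p = 2 * m by omega)
          (lefschetzPowTo (complexBetti.map f 2 κ) s (2 * p) (2 * p + 2 * s) rfl y) y ≠ 0) →
      ∀ (x : complexBetti X (2 * p)),
      complexBetti.map f (2 * p) x ∈ Submodule.span ℂ
        {r : complexBetti Y (2 * p) | IsRationalClass r ∧ IsOfHodgeType m Y (2 * p) p p r} →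
      lefschetzPowTo (complexBetti.map f 2 κ) (s + 1) (2 * p) (2 * p + 2 * (s + 1)) rfl
        (complexBetti.map f (2 * p) x) = 0 →
      (∀ y : complexBetti X k,
        cupProduct hk (complexBetti.map f (2 * p) x) (complexBetti.map f k y) = 0) →
      complexBetti.map f (2 * p) x = 0)
    (hR : ∀ ⦃n m p q : ℕ⦄ ⦃X Y : SchemeOver ℂ⦄ (f : Y ⟶ X) (hX : IsSmoothProjective n X)
      (hY : IsSmoothProjective m Y) (hpq : 2 * p + 2 * n = 2 * q + 2 * m) (x : complexBetti X (2 * p)),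
      complexGysin complexOrientationFamily hY hX f hpq (complexBetti.map f (2 * p) x) ∈
          algebraicClasses X q →
        ∃ a ∈ algebraicClasses X p,
          complexGysin complexOrientationFamily hY hX f hpq (complexBetti.map f (2 * p) a) =
            complexGysin complexOrientationFamily hY hX f hpq (complexBetti.map f (2 * p) x)) :
    ∀ ⦃n m p : ℕ⦄ ⦃X Y : SchemeOver ℂ⦄ (f : Y ⟶ X), IsSmoothProjective n X → IsSmoothProjective m Y →
      IsClosedImmersion f.left → ∀ (s : Finset X.left.Opens), (∀ U ∈ s, IsAffineOpen U) →
      (⋃ U ∈ s, (U : Set X.left)) = (Set.range f.left.base)ᶜ → 2 * p + s.card ≤ n →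
      ∀ c ∈ algebraicClasses Y p, c ∈ LinearMap.range (complexBetti.map f (2 * p)).hom →
      ∃ a ∈ algebraicClasses X p, complexBetti.map f (2 * p) a = c := by
  intro n m p X Y f hX hY hf s hs hcov hle c hc hcr
  haveI : IsClosedImmersion f.left := hf
  have hmn : m ≤ n := dim_le_of_isClosedImmersion hX hY f
  -- degenerate range: above the real dimension of `Y(ℂ)` the carrier is trivial and `a = 0` serves
  by_cases hpm : 2 * m < 2 * p
  · haveI := subsingleton_complexBetti hY hpm
    exact ⟨0, Submodule.zero_mem _, Subsingleton.elim _ _⟩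
  -- the Gysin degree `2q = 2p + 2(n - m)`
  have hpq : 2 * p + 2 * n = 2 * (p + n - m) + 2 * m := by omega
  -- `c = f^* a₀`
  obtain ⟨a₀, rfl⟩ := LinearMap.mem_range.1 hcr
  -- transport: `f_* c` is algebraic on `X`
  have hGc : complexGysin complexOrientationFamily hY hX f hpq ((complexBetti.map f (2 * p)).hom a₀) ∈
      algebraicClasses X (p + n - m) :=
    complexGysin_mem_algebraicClasses (gysinMap_restrictCompl_eq_zero_of_field ℂ)
      complexOrientationFamily hasPoincareDuality_complexOrientationFamily hY hX f (by omega) hpq hc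
  -- reflection: an algebraic `a` with `f_* f^* a = f_* f^* a₀`
  obtain ⟨a, ha, hGa⟩ := hR f hX hY hpq a₀ hGc
  refine ⟨a, ha, ?_⟩
  -- the difference `x = a - a₀` has `f_* f^* x = 0`
  set x : complexBetti X (2 * p) := a - a₀ with hxdef
  have hzero : complexGysin complexOrientationFamily hY hX f hpq (complexBetti.map f (2 * p) x) = 0 := by
    rw [hxdef, map_sub, map_sub, hGa, sub_self]
  -- it suffices that `f^* x = 0`
  suffices hfx : complexBetti.map f (2 * p) x = 0 by
    rw [hxdef, map_sub, sub_eq_zero] at hfx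
    exact hfx
  -- transpose: `f^* x ⊥ f^* H^{2m-2p}(X)`
  have hk : 2 * p + (2 * m - 2 * p) = 2 * m := by omega
  have horth : ∀ y : complexBetti X (2 * m - 2 * p),
      cupProduct hk (complexBetti.map f (2 * p) x) (complexBetti.map f (2 * m - 2 * p) y) = 0 :=
    hB f hX hY hpq hk (complexBetti.map f (2 * p) x) hzero
  -- weak Lefschetz surjectivity in the affine-cover range
  have hsurj : ∀ i : ℕ, i + s.card + 1 ≤ n → Function.Surjective (complexBetti.map f i) :=
    fun i hi ↦ hA f hX hf s hs hcov i hi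
  rcases Nat.lt_or_ge m (2 * p) with hlt | hge
  · -- above the middle of `Y`: Poincaré duality alone
    exact hC0 f hY hk x (hsurj _ (by omega)) horth
  · -- at or below the middle of `Y`: `m = 2p + s'`
    obtain ⟨s', hs'⟩ : ∃ s' : ℕ, 2 * p + s' = m := ⟨m - 2 * p, by omega⟩
    -- the Kähler class of `Y` restricted from a projective embedding `Y ⟶ X ⟶ ℙᴺ`
    obtain ⟨N, ι, hι⟩ := hX.isProjectiveOver
    haveI := hι
    haveI : IsClosedImmersion (f ≫ ι).left := by
      rw [Over.comp_left]
      infer_instance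
    obtain ⟨D, c₀, hD⟩ := exists_kaehlerRationalDatum_eq_map hY (f ≫ ι)
    have hfκ : complexBetti.map f 2 (complexBetti.map ι 2 c₀) = D.Hη := by
      rw [hD, complexBetti.map_comp]
      rfl
    -- generalise the restricted class
    obtain ⟨κ, hκ⟩ : ∃ κ : complexBetti X 2, complexBetti.map f 2 κ = D.Hη := ⟨_, hfκ⟩
    have hHL : HasHardLefschetzProperty (complexBetti.map f 2 κ) m := by
      rw [hκ]
      exact D.hasHardLefschetzProperty hY
    have hrat : IsRationalClass (complexBetti.map f 2 κ) := by
      rw [hκ]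
      exact D.isRationalClass_Hη
    have hHR : ∀ y : complexBetti Y (2 * p), IsRationalClass y → IsOfHodgeType m Y (2 * p) p p y →
        lefschetzPowTo (complexBetti.map f 2 κ) (s' + 1) (2 * p) (2 * p + 2 * (s' + 1)) rfl y = 0 →
        y ≠ 0 →
        cupProduct (show 2 * p + 2 * s' + 2 * p = 2 * m by omega)
          (lefschetzPowTo (complexBetti.map f 2 κ) s' (2 * p) (2 * p + 2 * s') rfl y) y ≠ 0 := by
      rw [hκ]
      intro y hyQ hyT hprim hy0
      exact D.isKaehlerClassVia.hodgeRiemann_anisotropy D.B D.isNatural D.isMultiplicative hY p s' hs'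
        y hyQ hyT hprim hy0
    -- the Lefschetz reduction: `f^* x` is primitive
    have hprim := hC1 f hY hs' hk κ hHL (fun i hi ↦ hsurj i (by omega)) x horth
    -- `f^* x = f^* a - c` lies in the span of the rational `(p,p)`-classes of `Y`
    have hspan : complexBetti.map f (2 * p) x ∈ Submodule.span ℂ
        {r : complexBetti Y (2 * p) | IsRationalClass r ∧ IsOfHodgeType m Y (2 * p) p p r} := by
      rw [hxdef, map_sub]
      refine Submodule.sub_mem _ ?_ (algebraicClasses_le_span_rational_pp hY p hc)
      exact map_span_rational_pp_le hX hY f hmn p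
        (Submodule.mem_map_of_mem (algebraicClasses_le_span_rational_pp hX p ha))
    -- the anisotropy step
    exact hC2 f hX hY hs' hk κ hrat hHR x hspan hprim horth

/-! ## The skeleton theorem: the crux BY NAME from the six declared stubs -/

/-- **THE SKELETON THEOREM.** The crux
`Summit.HodgeConjecture.HodgeConjecture.Theses.AmpleAdicLefschetz.ThickDescent`, concluded BY NAME from
the six DECLARED stubs (the only `sorry`s of the file) through the sorry-free composition
`thickDescent_of_pieces`. [cite: Hartshorne1974Cycles] [cite: Voisin2025, §2.1 and Cor. 2.12] -/
theorem ThickDescent_of :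
    Summit.HodgeConjecture.HodgeConjecture.Theses.AmpleAdicLefschetz.ThickDescent :=
  thickDescent_of_pieces stub_weakLefschetzSurjective stub_gysinZero_cup stub_transversal_aboveMiddle
    stub_primitive_of_orthogonal stub_anisotropicKernel stub_gysinPullbackReflectsAlgebraic

end Summit.HodgeConjecture.HodgeConjecture.Cruxes.ThickDescent.Birth

end
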